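import Mathlib
import Summits.NavierStokesRegularity.NavierStokesRegularity.Theses.PicardRadiiRungThree
import Summits.NavierStokesRegularity.NavierStokesRegularity.Theorems.PicardRadiiRungThreeRadiiGlueREpoch
import HarnessLib

/-!
# `PicardRadiiRungThree.RadiiGlueR` (item stmt-NavierStokesRegularity-23947, the extraction glue of
  route PicardRadiiRungThree)

The repaired extraction glue of the Newton–Kantorovich window line at rung TL-M3 of the Tao ladder
(MODEL lattice ODEs only): the path-space radii-polynomial certificate `PicardRadiiCertificateR`
(per stage and per tube restart: Picard operators `G j σ z` with horizon `(1−σ)τs`, injective approximate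
inverses `A`, defect `Y₀`, contraction `Z < 1` on the `r₂`-ball, `Y₀ + Z r₁ ≤ r₁`, `‖A‖ ≤ Λ(1−Z)`,
base-point coherence in the `κ`-tube, level bracket `T₁ ≤ T₂`, static exit/landing clauses on the
section, margins) implies the exact-flow window certificate `ExactFlowCertificateR` (exact trajectories
of the window-truncated cascade from every entry state, in-bounds margins, crossing time `τq ≤ τs` with
`|x_{i₀,1}(τq)| ≥ as`, landing, exit, and the TUBE clause with reach `t + u ≤ τq`).

PROOF: the static clauses are copied verbatim; for each stage `j ≤ N₀` and entry `q ∈ B_j` the EPOCH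
clause is `RadiiGlueR.stage_epoch` (tree NK theorem `existsUnique_zero_of_newtonLike_twoRadii_of_le` at
`σ = 0` and at every restart `σ = t/τs`; FTC for the Picard fixed point; componentwise time rescaling;
IVT for the crossing time; parameter-Lipschitz dependence of the NK zero for the tube).

HONEST FRAMING: an implication between two certificate SHAPES for Tao-type MODEL lattice ODEs; the
certificate `PicardRadiiCertificateR` itself (crux K1nR, an instrument row) is NOT established here and
remains OPEN; nothing here is a statement about the Navier–Stokes equations; the route's leaf
`TaoLadderRungThree.Target` (TL-M3) is not the summit Statement; NS regularity is NOT proved by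
anything in this file.
-/

noncomputable section

-- the sub-problem namespace repeats the summit name by design (D-0017)
set_option linter.dupNamespace false

namespace Summit.NavierStokesRegularity.NavierStokesRegularity.Theorems

open Set Metric Function MeasureTheory intervalIntegral Literature.Analysis.FluidPDE
  Literature.Analysis.FluidPDE.TaoCascade RadiiGlueR

/-- **Item stmt-NavierStokesRegularity-23947 (`PicardRadiiRungThree.RadiiGlueR`).** The path-space
Newton–Kantorovich certificate implies the exact-flow window certificate (repaired reach `t + u ≤ τq`);
see the module docstring. MODEL lattice statement (rung TL-M3); nothing about Navier–Stokes is concluded.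
[cite: ConstantineauGarciaAzpeitiaLessard2021, Thm. 3.1; Tao2016AveragedNS, §4 (4.8); route PicardRadiiRungThree, glue] -/
theorem picardRadiiRungThree_radiiGlueR_proof :
    Summit.NavierStokesRegularity.NavierStokesRegularity.Theses.PicardRadiiRungThree.RadiiGlueR := by
  unfold Summit.NavierStokesRegularity.NavierStokesRegularity.Theses.PicardRadiiRungThree.RadiiGlueR
    Summit.NavierStokesRegularity.NavierStokesRegularity.Theses.PicardRadiiRungThree.PicardRadiiCertificateR
    Summit.NavierStokesRegularity.NavierStokesRegularity.Theses.PicardRadiiRungThree.ExactFlowCertificateR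
  intro h
  obtain ⟨R, θ, c, η₀, Cb, Cg, τs, mm, Kb, Ka, i₀, α, X₀, M, W, N₀, ℓ, ctr, rad, s, ω, Lv, as, κ, Λ, δ,
    r₁, r₂, Y₀, Z, L, T₁, T₂, nx, hrest⟩ := h
  obtain ⟨xb, G, G', A, hR, hα, hX₀, hθ0, hθ, hc, hη₀, hη₀1, hCb, hCg, hKb, hKa, hτs, hτsc, hmm, hMW,
    hPC1, hPC2, hPC3, hWC, hdat, hstat, hstages⟩ := hrest
  refine ⟨R, θ, c, η₀, Cb, Cg, τs, mm, Kb, Ka, i₀, α, X₀, M, W, N₀, ℓ, ctr, rad, s, ω, Lv, as, κ, Λ, δ,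
    nx, hR, hα, hX₀, hθ0, hθ, hc, hη₀, hη₀1, hCb, hCg, hKb, hKa, hτs, hτsc, hmm, hMW, hPC1, hPC2, hPC3,
    hWC, hdat, hstat, ?_⟩
  intro j hj q hq
  obtain ⟨hr, hZ1, hp, hT₁, hT₁₂, hT₂, hasL, hG, hentry⟩ := hstages j hj
  obtain ⟨hNK0, hmarg, htube, hlev₁, hlev₂, hsec⟩ := hentry q hq
  obtain ⟨-, -, -, hκ, -, -, hω, -⟩ := hstat j hj
  -- the stage's objects, named
  set fE : (Fin 4 → ↥(Finset.Icc (-Kb) Ka) → ℝ) → Fin 4 → ℤ → ℝ :=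
    fun e i n => if h : -Kb ≤ n ∧ n ≤ Ka then e i ⟨n, Finset.mem_Icc.mpr h⟩ else 0 with hfE_def
  have hfE1 : ∀ e i n (h : -Kb ≤ n ∧ n ≤ Ka), fE e i n = e i ⟨n, Finset.mem_Icc.mpr h⟩ := by
    intro e i n h; simp only [hfE_def, dif_pos h]
  have hfE0 : ∀ e i n, ¬ (-Kb ≤ n ∧ n ≤ Ka) → fE e i n = 0 := by
    intro e i n h; simp only [hfE_def, dif_neg h]
  set Q : (Fin 4 → ↥(Finset.Icc (-Kb) Ka) → ℝ) → (Fin 4 → ↥(Finset.Icc (-Kb) Ka) → ℝ) :=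
    fun e i k => quadTerm 1 α (fun j' n (_ : ℝ) => ω j n * fE e j' n) i k 0 / ω j k with hQ_def
  have hQ : ∀ e i (k : ↥(Finset.Icc (-Kb) Ka)),
      Q e i k = quadTerm 1 α (fun j' n (_ : ℝ) => ω j n * fE e j' n) i k 0 / ω j k := fun _ _ _ => rfl
  have hQc : Continuous Q :=
    continuous_scaledField α (ω j) fE (fun i n => continuous_fE i n) Q hQ
  set zq : Fin 4 → ↥(Finset.Icc (-Kb) Ka) → ℝ := fun i k => q i k / ω j k with hzq_def
  obtain ⟨τq, x, h1, h2, h3, h4, ⟨hexit, hland⟩, htube'⟩ :=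
    stage_epoch α hω fE hfE1 hfE0 Q hQ hQc (xb j) (G j) (G' j) (A j) (τs := τs) (Y₀ := Y₀ j)
      (Z := Z j) (Λ := Λ j) (r₁ := r₁ j) (r₂ := r₂ j) (κ := κ j) (δ := δ j) (mm := mm) (T₁ := T₁ j)
      (T₂ := T₂ j) (L := L j) (as := as j) (M := M) (i₀ := i₀) hG
      (fun σ z => Injective (A j σ z) ∧ ‖A j σ z (G j σ z (xb j σ z))‖ ≤ Y₀ j ∧
        ‖A j σ z‖ ≤ Λ j * (1 - Z j) ∧
        (∀ x, ‖x - xb j σ z‖ ≤ r₂ j → HasFDerivAt (G j σ z) (G' j σ x) x ∧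
          ‖ContinuousLinearMap.id ℝ _ - (A j σ z).comp (G' j σ x)‖ ≤ Z j) ∧
        ∀ (t : ℝ) (i : Fin 4) (k : ℤ), -Kb ≤ k → k ≤ Ka →
          ω j k * (|fE (IccExtend zero_le_one (xb j σ z) t) i k| + r₂ j) ≤ M k)
      (fun σ z h => h) hτs hr hZ1 hp hκ.le hKa hKb hT₁ hT₁₂ hT₂ hasL
      (fun w a => (∀ i, |w i (-Kb)| + Λ j * δ j * τs * ω j (-Kb) ≤
          (2 : ℝ) ^ (-θ) * (Cb * (2 : ℝ) ^ ((3 : ℝ) / 4 * ((Kb : ℝ) + 1)))) ∧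
        ∀ v : Fin 4 → ℝ, (∀ i, |v i| ≤ Real.sqrt (10 * Cg * (2 : ℝ) ^ (-(7 : ℝ) * ((Ka : ℝ) + 1)))) →
          ∀ l, |ℓ (nx j) l (fun i k => Lv (nx j) * (if k + 1 ≤ Ka then w i (1 + k) else v i) / a) -
            ctr (nx j) l| ≤ rad (nx j) l - s (nx j) l)
      q zq (fun _ _ => rfl) hNK0 hmarg htube hlev₁ hlev₂ hsec
  exact ⟨τq, x, h1, h2, h3, h4, hland, hexit, htube'⟩

end Summit.NavierStokesRegularity.NavierStokesRegularity.Theorems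

end
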